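import Literature.AlgebraicGeometry.Resolution.HasseSchmidtDiffEqDiffOp
import Mathlib.RingTheory.Smooth.Basic
import Mathlib.RingTheory.MvPolynomial.Ideal
import Mathlib.LinearAlgebra.Quotient.Basic
import HarnessLib

/-!
# Truncated Hasse–Schmidt systems on algebras formally smooth over a polynomial ring

Let `k` be a commutative ring, `ι` a finite index set, and `B` a commutative `k`-algebra equipped with a
structure of algebra over `A = k[X_i : i ∈ ι]` (compatible with `k`), i.e. with chosen elements
`x_i = X_i · 1_B`. If `B` is **formally smooth over `A`** (e.g. `x` an étale coordinate system of a smooth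
`k`-algebra), then for every `n` the infinitesimal lifting property, applied once to the `A`-algebra
`T_n = B[t_i]/(t)^{n+1}` with `A` acting through the Taylor substitution `X_i ↦ x_i + t_i` and to the
nilpotent surjection `T_n → B`, `t ↦ 0`, produces an `A`-algebra map `ψ : B → T_n` over `id_B`; its
coefficients `Δ_q(b) = coeff_{t^q} ψ(b)`, `|q| ≤ n`, form a **truncated Hasse–Schmidt system of level `n`
along `x`**: `Δ_0 = id`, `Δ_q(fg) = Σ_{q₁+q₂=q} Δ_{q₁}(f)Δ_{q₂}(g)`, and on the monomials `x^β` the `Δ_q` take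
the values of the divided partial derivatives (`Δ_β(x^β) = 1`, `Δ_q(x^β) = 0` for `q ≰ β`) — because
`ψ(x^β) = (x + t)^β`, whose `t`-coefficients are the Hasse–Schmidt derivatives of `X^β` evaluated at `x`
(`HasseSchmidtDerivatives.lean`, `HasseSchmidtDiffEqDiffOp.lean`).

Main statement: `exists_hasseSystem_of_formallySmooth`. Combined with `DiffOpCoordinateSpan.lean` this gives
EGA IV₄ 16.11.2 / the Leibniz inclusion for `Diff^{≤ n}` on such `B` (used for smooth algebras over a field via
étale coordinates; Hironaka 2017 ms. Lem. 4.2, campaign res-hironaka lane HIRONAKA-L — nothing of that manuscript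
is used or asserted here).

## References

* [EGAIV4] A. Grothendieck, J. Dieudonné, ÉGA IV₄, Publ. Math. IHÉS 32 (1967), Thm. 16.11.2 and its proof
  (16.11.2.1)–(16.11.2.2) (the D_q from the Taylor development along a formally étale coordinate system),
  Prop. 17.1.1 / Déf. 17.1.1 (infinitesimal lifting for formally smooth morphisms).
-/

open scoped BigOperators
open MvPolynomial

namespace Literature.AlgebraicGeometry.Resolution

section HasseSystemExistence

variable {B : Type*} [CommRing B] {ι : Type*}

/-- Coefficients of total degree `< m` vanish on the `m`-th power of the ideal `(t_i : i ∈ ι)` of `B[t]`.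
[cite: EGAIV4, Thm. 16.11.2 (proof: truncation of the Taylor development modulo (t)^{m})] -/
theorem coeff_eq_zero_of_mem_span_X_pow [DecidableEq ι] :
    ∀ (m : ℕ) {p : MvPolynomial ι B}, p ∈ Ideal.span (Set.range (X : ι → MvPolynomial ι B)) ^ m →
      ∀ {q : ι →₀ ℕ}, q.degree < m → coeff q p = 0
  | 0, _, _, _, hq => absurd hq (Nat.not_lt_zero _)
  | m + 1, p, hp, q, hq => by
    rw [pow_succ] at hp
    revert q
    refine Submodule.mul_induction_on hp (fun a ha b hb => ?_) (fun y z hy hz => ?_)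
    · intro q hq
      rw [coeff_mul]
      refine Finset.sum_eq_zero fun r hr => ?_
      rw [Finset.mem_antidiagonal] at hr
      by_cases h2 : r.2 = 0
      · -- the constant coefficient of `b ∈ (t)` vanishes
        have hb0 : coeff 0 b = 0 := by
          rw [← Set.image_univ] at hb
          have hb' := (mem_ideal_span_X_image.mp hb)
          by_contra hne
          obtain ⟨i, -, hi⟩ := hb' 0 (Finsupp.mem_support_iff.mpr hne)
          exact hi rfl
        rw [h2, hb0, mul_zero]
      · have hdeg : q.degree = r.1.degree + r.2.degree := by rw [← hr, map_add]
        have h2' : 0 < r.2.degree := Nat.pos_of_ne_zero fun h => h2 ((Finsupp.degree_eq_zero_iff _).mp h)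
        rw [coeff_eq_zero_of_mem_span_X_pow m ha (q := r.1) (by omega), zero_mul]
    · intro q hq
      rw [coeff_add, hy q hq, hz q hq, add_zero]

/-- Conversely a polynomial of `B[t]` with vanishing constant coefficient lies in `(t_i : i ∈ ι)`.
[cite: EGAIV4, Thm. 16.11.2 (proof: the augmentation ideal of the Taylor algebra)] -/
theorem mem_span_X_of_coeff_zero_eq_zero {p : MvPolynomial ι B} (hp : coeff 0 p = 0) :
    p ∈ Ideal.span (Set.range (X : ι → MvPolynomial ι B)) := by
  rw [← Set.image_univ, mem_ideal_span_X_image]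
  intro m hm
  have hm0 : m ≠ 0 := by
    rintro rfl
    exact (Finsupp.mem_support_iff.mp hm) hp
  obtain ⟨i, hi⟩ := Finsupp.ne_iff.mp hm0
  exact ⟨i, Set.mem_univ i, hi⟩

/-- The Taylor polynomial `∏ (x_i + t_i)^{β_i} ∈ B[t]` of the monomial `x^β` is the evaluation at `x` of the
Taylor development of `X^β`: its `t^q`-coefficient is `(D^{(q)} X^β)(x)`.
[cite: EGAIV4, Thm. 16.11.2 ((16.11.2.1): the coefficients of (z + t)^q are the D_p(z^q))] -/
theorem coeff_prod_C_add_X_pow [Fintype ι] [DecidableEq ι] (x : ι → B) (β q : ι →₀ ℕ) :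
    coeff q (∏ i, (C (x i) + X i) ^ β i : MvPolynomial ι B) =
      eval x (hasseDeriv B q (monomial β (1 : B))) := by
  have hprod : (∏ i, (C (x i) + X i) ^ β i : MvPolynomial ι B) =
      MvPolynomial.map (eval x) (taylor B (monomial β (1 : B))) := by
    rw [monic_monomial_eq, Finsupp.prod_fintype _ _ (fun i => pow_zero _), map_prod, map_prod]
    refine Finset.prod_congr rfl fun i _ => ?_
    rw [map_pow, map_pow, taylor_X, map_add, map_C, map_X, eval_X]
  rw [hprod, coeff_map, hasseDeriv_apply]

variable (k : Type*) [CommRing k] [Algebra k B]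
  [Algebra (MvPolynomial ι k) B] [IsScalarTower k (MvPolynomial ι k) B]

/-- **Existence of truncated Hasse–Schmidt systems.** If `B` is formally smooth over the polynomial ring
`k[X_i : i ∈ ι]` (`ι` finite) — structure map `X_i ↦ x_i` — then for every `n` there are `k`-linear maps
`Δ_q : B → B`, `q ∈ ℕ^ι`, with `Δ_0 = id`, the higher Leibniz rule for `|q| ≤ n`, and the values of the
divided partial derivatives on the monomials `x^β` (`Δ_β x^β = 1`, `Δ_q x^β = 0` for `q ≰ β`, `|q| ≤ n`).
(One application of the infinitesimal lifting property to `B → B[t]/(t)^{n+1} → B`, the polynomial ring acting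
on `B[t]/(t)^{n+1}` through `X_i ↦ x_i + t_i`.) [cite: EGAIV4, Thm. 16.11.2 (proof, via Prop. 17.1.1 / 16.5.?: lifting along the nilpotent thickening)] -/
theorem exists_hasseSystem_of_formallySmooth [Fintype ι] [DecidableEq ι]
    [Algebra.FormallySmooth (MvPolynomial ι k) B] (n : ℕ) :
    ∃ Δ : (ι →₀ ℕ) → (B →ₗ[k] B),
      (∀ b, Δ 0 b = b) ∧
      (∀ q : ι →₀ ℕ, q.degree ≤ n →
        ∀ f g : B, Δ q (f * g) = ∑ p ∈ Finset.antidiagonal q, Δ p.1 f * Δ p.2 g) ∧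
      (∀ β : ι →₀ ℕ, β.degree ≤ n →
        Δ β (∏ i, algebraMap (MvPolynomial ι k) B (X i) ^ β i) = 1) ∧
      (∀ q β : ι →₀ ℕ, q.degree ≤ n → ¬ q ≤ β →
        Δ q (∏ i, algebraMap (MvPolynomial ι k) B (X i) ^ β i) = 0) := by
  -- notation
  set x : ι → B := fun i => algebraMap (MvPolynomial ι k) B (X i) with hx
  let P := MvPolynomial ι B
  let 𝔫 : Ideal P := Ideal.span (Set.range (X : ι → P))
  let N : Ideal P := 𝔫 ^ (n + 1)
  let T := P ⧸ N
  let mk : P →+* T := Ideal.Quotient.mk N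
  -- the Taylor substitution `A → P`, `X_i ↦ x_i + t_i` (written through the tree's `taylor` so that its values
  -- on monomials are Taylor developments)
  let τ : MvPolynomial ι k →+* P :=
    (MvPolynomial.map (eval x)).comp ((taylor B).toRingHom.comp (MvPolynomial.map (algebraMap k B)))
  have hτX : ∀ i, τ (X i) = C (x i) + X i := fun i => by
    simp only [τ, RingHom.comp_apply, AlgHom.toRingHom_eq_coe, AlgHom.coe_toRingHom, map_X, taylor_X,
      map_add, map_C, eval_X]
  have hτC : ∀ r : k, τ (C r) = C (algebraMap k B r) := fun r => by
    simp only [τ, RingHom.comp_apply, AlgHom.toRingHom_eq_coe, AlgHom.coe_toRingHom, map_C, taylor_C, eval_C]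
  have hτmon : ∀ β : ι →₀ ℕ, τ (monomial β 1) = MvPolynomial.map (eval x) (taylor B (monomial β (1 : B))) := by
    intro β
    simp only [τ, RingHom.comp_apply, AlgHom.toRingHom_eq_coe, AlgHom.coe_toRingHom, map_monomial, map_one]
  -- `constantCoeff ∘ τ = algebraMap A B`
  have hτ0 : (constantCoeff.comp τ : MvPolynomial ι k →+* B) = algebraMap (MvPolynomial ι k) B := by
    refine MvPolynomial.ringHom_ext (fun r => ?_) (fun i => ?_)
    · rw [RingHom.comp_apply, hτC, constantCoeff_C, ← MvPolynomial.algebraMap_eq,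
        ← IsScalarTower.algebraMap_apply]
    · rw [RingHom.comp_apply, hτX, map_add, constantCoeff_C, constantCoeff_X, add_zero]
  -- the `A`-algebra structure on `T` through `τ` (local instance)
  letI algT : Algebra (MvPolynomial ι k) T := (mk.comp τ).toAlgebra
  have halgT : ∀ a, algebraMap (MvPolynomial ι k) T a = mk (τ a) := fun a => rfl
  -- `g : T → B`, `t ↦ 0`, as an `A`-algebra map
  have hNker : ∀ p ∈ N, constantCoeff p = 0 := by
    intro p hp
    have h := coeff_eq_zero_of_mem_span_X_pow (n + 1) hp (q := 0) (by simp)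
    rw [show (constantCoeff p : B) = coeff 0 p from congrFun constantCoeff_eq p]
    exact h
  let g₀ : T →+* B := Ideal.Quotient.lift N constantCoeff hNker
  have hg₀ : ∀ p, g₀ (mk p) = constantCoeff p := fun p => Ideal.Quotient.lift_mk N _ _
  let g : T →ₐ[MvPolynomial ι k] B :=
    { g₀ with
      commutes' := fun a => by
        change g₀ (algebraMap _ T a) = _
        rw [halgT, hg₀, ← RingHom.comp_apply, hτ0] }
  have hg : ∀ p, g (mk p) = constantCoeff p := hg₀
  have hgsurj : Function.Surjective g := fun b => ⟨mk (C b), by rw [hg, constantCoeff_C]⟩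
  have hgker : IsNilpotent (RingHom.ker (g : T →+* B)) := by
    refine ⟨n + 1, ?_⟩
    have hle : RingHom.ker (g : T →+* B) ≤ 𝔫.map mk := by
      intro t ht
      obtain ⟨p, rfl⟩ := Ideal.Quotient.mk_surjective t
      rw [RingHom.mem_ker] at ht
      change g (mk p) = 0 at ht
      rw [hg] at ht
      refine Ideal.mem_map_of_mem _ (mem_span_X_of_coeff_zero_eq_zero ?_)
      rw [← show (constantCoeff p : B) = coeff 0 p from congrFun constantCoeff_eq p]
      exact ht
    refine le_bot_iff.mp ?_
    calc RingHom.ker (g : T →+* B) ^ (n + 1) ≤ (𝔫.map mk) ^ (n + 1) := Ideal.pow_right_mono hle _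
      _ = (𝔫 ^ (n + 1)).map mk := (Ideal.map_pow _ _ _).symm
      _ = ⊥ := Ideal.map_quotient_self _
  -- the lift
  let ψ : B →ₐ[MvPolynomial ι k] T :=
    Algebra.FormallySmooth.liftOfSurjective (AlgHom.id (MvPolynomial ι k) B) g hgsurj hgker
  have hψg : ∀ b, g (ψ b) = b := fun b =>
    Algebra.FormallySmooth.liftOfSurjective_apply (AlgHom.id (MvPolynomial ι k) B) g hgsurj hgker b
  have hψx : ∀ β : ι →₀ ℕ, ψ (∏ i, x i ^ β i) = mk (MvPolynomial.map (eval x) (taylor B (monomial β (1 : B)))) := by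
    intro β
    have h1 : (∏ i, x i ^ β i) = algebraMap (MvPolynomial ι k) B (monomial β 1) := by
      rw [monic_monomial_eq, Finsupp.prod_fintype _ _ (fun i => pow_zero _), map_prod]
      exact Finset.prod_congr rfl fun i _ => by rw [map_pow]
    rw [h1, ψ.commutes, halgT, hτmon]
  -- coefficient functionals on `T`
  have hNcoeff : ∀ q : ι →₀ ℕ, q.degree ≤ n →
      N.restrictScalars B ≤ LinearMap.ker (lcoeff B q : P →ₗ[B] B) := by
    intro q hq p hp
    rw [LinearMap.mem_ker, lcoeff_apply]
    exact coeff_eq_zero_of_mem_span_X_pow (n + 1) hp (by omega)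
  let cT : (ι →₀ ℕ) → (T →ₗ[B] B) := fun q =>
    if hq : q.degree ≤ n then
      ((N.restrictScalars B).liftQ (lcoeff B q) (hNcoeff q hq)) ∘ₗ
        (Submodule.Quotient.restrictScalarsEquiv B N).symm.toLinearMap
    else 0
  have hcT : ∀ q : ι →₀ ℕ, q.degree ≤ n → ∀ p : P, cT q (mk p) = coeff q p := by
    intro q hq p
    simp only [cT, dif_pos hq, LinearMap.comp_apply, LinearEquiv.coe_toLinearMap]
    rw [← Ideal.Quotient.mk_eq_mk, Submodule.Quotient.restrictScalarsEquiv_symm_mk,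
      Submodule.liftQ_apply, lcoeff_apply]
  have hcT0 : ∀ t : T, cT 0 t = g t := by
    intro t
    obtain ⟨p, rfl⟩ := Ideal.Quotient.mk_surjective t
    rw [hcT 0 (by simp), hg]; rfl
  have hcTmul : ∀ q : ι →₀ ℕ, q.degree ≤ n → ∀ t t' : T,
      cT q (t * t') = ∑ r ∈ Finset.antidiagonal q, cT r.1 t * cT r.2 t' := by
    intro q hq t t'
    obtain ⟨p, rfl⟩ := Ideal.Quotient.mk_surjective t
    obtain ⟨p', rfl⟩ := Ideal.Quotient.mk_surjective t'
    rw [← map_mul, hcT q hq, coeff_mul]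
    refine Finset.sum_congr rfl fun r hr => ?_
    rw [Finset.mem_antidiagonal] at hr
    have hdeg : q.degree = r.1.degree + r.2.degree := by rw [← hr, map_add]
    rw [hcT r.1 (by omega), hcT r.2 (by omega)]
  have hcTC : ∀ (q : ι →₀ ℕ) (c : B) (t : T), cT q (mk (C c) * t) = c * cT q t := by
    intro q c t
    obtain ⟨p, rfl⟩ := Ideal.Quotient.mk_surjective t
    by_cases hq : q.degree ≤ n
    · rw [← map_mul, hcT q hq, hcT q hq, coeff_C_mul]
    · simp [cT, dif_neg hq]
  -- the system
  let Δ : (ι →₀ ℕ) → (B →ₗ[k] B) := fun q =>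
    { toFun := fun b => cT q (ψ b)
      map_add' := fun b b' => by rw [map_add, map_add]
      map_smul' := fun r b => by
        rw [RingHom.id_apply, Algebra.smul_def, Algebra.smul_def]
        have hr : algebraMap k B r = algebraMap (MvPolynomial ι k) B (C r) := by
          rw [← MvPolynomial.algebraMap_eq, ← IsScalarTower.algebraMap_apply]
        have h1 : ψ (algebraMap k B r * b) = mk (C (algebraMap k B r)) * ψ b := by
          conv_lhs => rw [hr, map_mul, ψ.commutes, halgT, hτC]
        rw [h1, hcTC] }
  have hΔ : ∀ q b, Δ q b = cT q (ψ b) := fun q b => rfl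
  refine ⟨Δ, fun b => ?_, fun q hq f g' => ?_, fun β hβ => ?_, fun q β hq hqβ => ?_⟩
  · rw [hΔ, hcT0, hψg]
  · simp only [hΔ]
    rw [map_mul, hcTmul q hq]
  · rw [hΔ, hψx, hcT β hβ, coeff_map, ← hasseDeriv_apply, hasseDeriv_monomial_self, eval_C]
  · rw [hΔ, hψx, hcT q hq, coeff_map, ← hasseDeriv_apply, hasseDeriv_monomial_eq_zero_of_not_le B hqβ,
      map_zero]

/-- **Existence of truncated Hasse–Schmidt systems, with the values on ALL monomials.** Same construction as
`exists_hasseSystem_of_formallySmooth`, exporting the full Taylor values: for `|q| ≤ n` and every `β`,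
`Δ_q(x^β) = (D^{(q)} X^β)(x)` = `(∏_{i ∈ supp q} (β_i choose q_i)) · x^{β − q}` (divided-power Leibniz values;
`hasseDeriv_monomial`), from which `Δ_β x^β = 1`, `Δ_q x^β = 0` (`q ≰ β`) and `Δ_q x^β ∈ (x)` (`q < β`) follow.
Consumers: order criteria at closed points (`Δ_β` applied to `h = Σ_{|β|=n} c_β x^β + 𝔪^{n+1}`).
[cite: EGAIV4, Thm. 16.11.2 ((16.11.2.1)–(16.11.2.2))] -/
theorem exists_hasseSystem_of_formallySmooth_eval [Fintype ι] [DecidableEq ι]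
    [Algebra.FormallySmooth (MvPolynomial ι k) B] (n : ℕ) :
    ∃ Δ : (ι →₀ ℕ) → (B →ₗ[k] B),
      (∀ b, Δ 0 b = b) ∧
      (∀ q : ι →₀ ℕ, q.degree ≤ n →
        ∀ f g : B, Δ q (f * g) = ∑ p ∈ Finset.antidiagonal q, Δ p.1 f * Δ p.2 g) ∧
      (∀ q β : ι →₀ ℕ, q.degree ≤ n →
        Δ q (∏ i, algebraMap (MvPolynomial ι k) B (X i) ^ β i) =
          ((∏ i ∈ q.support, (β i).choose (q i) : ℕ) : B) *
            ∏ i, algebraMap (MvPolynomial ι k) B (X i) ^ (β - q) i) := by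
  -- notation
  set x : ι → B := fun i => algebraMap (MvPolynomial ι k) B (X i) with hx
  let P := MvPolynomial ι B
  let 𝔫 : Ideal P := Ideal.span (Set.range (X : ι → P))
  let N : Ideal P := 𝔫 ^ (n + 1)
  let T := P ⧸ N
  let mk : P →+* T := Ideal.Quotient.mk N
  -- the Taylor substitution `A → P`, `X_i ↦ x_i + t_i` (written through the tree's `taylor` so that its values
  -- on monomials are Taylor developments)
  let τ : MvPolynomial ι k →+* P :=
    (MvPolynomial.map (eval x)).comp ((taylor B).toRingHom.comp (MvPolynomial.map (algebraMap k B)))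
  have hτX : ∀ i, τ (X i) = C (x i) + X i := fun i => by
    simp only [τ, RingHom.comp_apply, AlgHom.toRingHom_eq_coe, AlgHom.coe_toRingHom, map_X, taylor_X,
      map_add, map_C, eval_X]
  have hτC : ∀ r : k, τ (C r) = C (algebraMap k B r) := fun r => by
    simp only [τ, RingHom.comp_apply, AlgHom.toRingHom_eq_coe, AlgHom.coe_toRingHom, map_C, taylor_C, eval_C]
  have hτmon : ∀ β : ι →₀ ℕ, τ (monomial β 1) = MvPolynomial.map (eval x) (taylor B (monomial β (1 : B))) := by
    intro β
    simp only [τ, RingHom.comp_apply, AlgHom.toRingHom_eq_coe, AlgHom.coe_toRingHom, map_monomial, map_one]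
  -- `constantCoeff ∘ τ = algebraMap A B`
  have hτ0 : (constantCoeff.comp τ : MvPolynomial ι k →+* B) = algebraMap (MvPolynomial ι k) B := by
    refine MvPolynomial.ringHom_ext (fun r => ?_) (fun i => ?_)
    · rw [RingHom.comp_apply, hτC, constantCoeff_C, ← MvPolynomial.algebraMap_eq,
        ← IsScalarTower.algebraMap_apply]
    · rw [RingHom.comp_apply, hτX, map_add, constantCoeff_C, constantCoeff_X, add_zero]
  -- the `A`-algebra structure on `T` through `τ` (local instance)
  letI algT : Algebra (MvPolynomial ι k) T := (mk.comp τ).toAlgebra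
  have halgT : ∀ a, algebraMap (MvPolynomial ι k) T a = mk (τ a) := fun a => rfl
  -- `g : T → B`, `t ↦ 0`, as an `A`-algebra map
  have hNker : ∀ p ∈ N, constantCoeff p = 0 := by
    intro p hp
    have h := coeff_eq_zero_of_mem_span_X_pow (n + 1) hp (q := 0) (by simp)
    rw [show (constantCoeff p : B) = coeff 0 p from congrFun constantCoeff_eq p]
    exact h
  let g₀ : T →+* B := Ideal.Quotient.lift N constantCoeff hNker
  have hg₀ : ∀ p, g₀ (mk p) = constantCoeff p := fun p => Ideal.Quotient.lift_mk N _ _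
  let g : T →ₐ[MvPolynomial ι k] B :=
    { g₀ with
      commutes' := fun a => by
        change g₀ (algebraMap _ T a) = _
        rw [halgT, hg₀, ← RingHom.comp_apply, hτ0] }
  have hg : ∀ p, g (mk p) = constantCoeff p := hg₀
  have hgsurj : Function.Surjective g := fun b => ⟨mk (C b), by rw [hg, constantCoeff_C]⟩
  have hgker : IsNilpotent (RingHom.ker (g : T →+* B)) := by
    refine ⟨n + 1, ?_⟩
    have hle : RingHom.ker (g : T →+* B) ≤ 𝔫.map mk := by
      intro t ht
      obtain ⟨p, rfl⟩ := Ideal.Quotient.mk_surjective t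
      rw [RingHom.mem_ker] at ht
      change g (mk p) = 0 at ht
      rw [hg] at ht
      refine Ideal.mem_map_of_mem _ (mem_span_X_of_coeff_zero_eq_zero ?_)
      rw [← show (constantCoeff p : B) = coeff 0 p from congrFun constantCoeff_eq p]
      exact ht
    refine le_bot_iff.mp ?_
    calc RingHom.ker (g : T →+* B) ^ (n + 1) ≤ (𝔫.map mk) ^ (n + 1) := Ideal.pow_right_mono hle _
      _ = (𝔫 ^ (n + 1)).map mk := (Ideal.map_pow _ _ _).symm
      _ = ⊥ := Ideal.map_quotient_self _
  -- the lift
  let ψ : B →ₐ[MvPolynomial ι k] T :=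
    Algebra.FormallySmooth.liftOfSurjective (AlgHom.id (MvPolynomial ι k) B) g hgsurj hgker
  have hψg : ∀ b, g (ψ b) = b := fun b =>
    Algebra.FormallySmooth.liftOfSurjective_apply (AlgHom.id (MvPolynomial ι k) B) g hgsurj hgker b
  have hψx : ∀ β : ι →₀ ℕ, ψ (∏ i, x i ^ β i) = mk (MvPolynomial.map (eval x) (taylor B (monomial β (1 : B)))) := by
    intro β
    have h1 : (∏ i, x i ^ β i) = algebraMap (MvPolynomial ι k) B (monomial β 1) := by
      rw [monic_monomial_eq, Finsupp.prod_fintype _ _ (fun i => pow_zero _), map_prod]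
      exact Finset.prod_congr rfl fun i _ => by rw [map_pow]
    rw [h1, ψ.commutes, halgT, hτmon]
  -- coefficient functionals on `T`
  have hNcoeff : ∀ q : ι →₀ ℕ, q.degree ≤ n →
      N.restrictScalars B ≤ LinearMap.ker (lcoeff B q : P →ₗ[B] B) := by
    intro q hq p hp
    rw [LinearMap.mem_ker, lcoeff_apply]
    exact coeff_eq_zero_of_mem_span_X_pow (n + 1) hp (by omega)
  let cT : (ι →₀ ℕ) → (T →ₗ[B] B) := fun q =>
    if hq : q.degree ≤ n then
      ((N.restrictScalars B).liftQ (lcoeff B q) (hNcoeff q hq)) ∘ₗ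
        (Submodule.Quotient.restrictScalarsEquiv B N).symm.toLinearMap
    else 0
  have hcT : ∀ q : ι →₀ ℕ, q.degree ≤ n → ∀ p : P, cT q (mk p) = coeff q p := by
    intro q hq p
    simp only [cT, dif_pos hq, LinearMap.comp_apply, LinearEquiv.coe_toLinearMap]
    rw [← Ideal.Quotient.mk_eq_mk, Submodule.Quotient.restrictScalarsEquiv_symm_mk,
      Submodule.liftQ_apply, lcoeff_apply]
  have hcT0 : ∀ t : T, cT 0 t = g t := by
    intro t
    obtain ⟨p, rfl⟩ := Ideal.Quotient.mk_surjective t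
    rw [hcT 0 (by simp), hg]; rfl
  have hcTmul : ∀ q : ι →₀ ℕ, q.degree ≤ n → ∀ t t' : T,
      cT q (t * t') = ∑ r ∈ Finset.antidiagonal q, cT r.1 t * cT r.2 t' := by
    intro q hq t t'
    obtain ⟨p, rfl⟩ := Ideal.Quotient.mk_surjective t
    obtain ⟨p', rfl⟩ := Ideal.Quotient.mk_surjective t'
    rw [← map_mul, hcT q hq, coeff_mul]
    refine Finset.sum_congr rfl fun r hr => ?_
    rw [Finset.mem_antidiagonal] at hr
    have hdeg : q.degree = r.1.degree + r.2.degree := by rw [← hr, map_add]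
    rw [hcT r.1 (by omega), hcT r.2 (by omega)]
  have hcTC : ∀ (q : ι →₀ ℕ) (c : B) (t : T), cT q (mk (C c) * t) = c * cT q t := by
    intro q c t
    obtain ⟨p, rfl⟩ := Ideal.Quotient.mk_surjective t
    by_cases hq : q.degree ≤ n
    · rw [← map_mul, hcT q hq, hcT q hq, coeff_C_mul]
    · simp [cT, dif_neg hq]
  -- the system
  let Δ : (ι →₀ ℕ) → (B →ₗ[k] B) := fun q =>
    { toFun := fun b => cT q (ψ b)
      map_add' := fun b b' => by rw [map_add, map_add]
      map_smul' := fun r b => by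
        rw [RingHom.id_apply, Algebra.smul_def, Algebra.smul_def]
        have hr : algebraMap k B r = algebraMap (MvPolynomial ι k) B (C r) := by
          rw [← MvPolynomial.algebraMap_eq, ← IsScalarTower.algebraMap_apply]
        have h1 : ψ (algebraMap k B r * b) = mk (C (algebraMap k B r)) * ψ b := by
          conv_lhs => rw [hr, map_mul, ψ.commutes, halgT, hτC]
        rw [h1, hcTC] }
  have hΔ : ∀ q b, Δ q b = cT q (ψ b) := fun q b => rfl
  refine ⟨Δ, fun b => ?_, fun q hq f g' => ?_, fun q β hq => ?_⟩
  · rw [hΔ, hcT0, hψg]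
  · simp only [hΔ]
    rw [map_mul, hcTmul q hq]
  · rw [hΔ, hψx, hcT q hq, coeff_map, ← hasseDeriv_apply, hasseDeriv_monomial, map_mul, map_natCast,
      eval_monomial, one_mul, Finsupp.prod_fintype _ _ (fun i => pow_zero _)]

end HasseSystemExistence

end Literature.AlgebraicGeometry.Resolution
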